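import Summits.CriticalPhenomena.PercolationContinuityZ3.Theses.PercNecklaceBackbone
import Literature.Probability.Percolation.HalfSpaceProofs
import Literature.Probability.Percolation.SharpnessQuasiTransitiveMeanField
import Literature.Probability.Percolation.SlabUniqueness
import HarnessLib

/-!
# Route PercNecklaceBackbone — `NoBackboneOfBelowSurface` (stmt-CriticalPhenomena-5270)

The engine glue `BackboneBelowSurface → NoBackbone` of route `PercNecklaceBackbone`:
if `Q(p) ≤ C · θ_ℍ(p)^a` for every `p > p_c(ℤ³)` with some `a > 0`, where
`Q(p) = P_p{ω | ∀ e, ω ∖ {e} ∈ {|C(0)| = ∞}}` is the cut-form backbone density and `θ_ℍ` the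
percolation probability of the induced half-space `{x₀ ≥ 0}` at its boundary origin, then
`Q(p_c) = 0`.

Proof (Grimmett 1999, §1.4 and Thm. (7.35)):

* `Q` is the probability of an increasing measurable event, so `Q(p_c) ≤ Q(p)` for `p ≥ p_c`
  (`DCT16.real_mono_of_isUpperSet`);
* `θ_ℍ` is upper semicontinuous: `θ_ℍ(p) ≤ P_p[0 ⟷ ∂B(0, n)]` for the balls of the half-space graph
  (`theta_le_real_armEvent`), each `p ↦ P_p[0 ⟷ ∂B(0, n)]` is continuous (a cylinder event,
  `continuous_bondPercolation_real_of_determinedBy`), and `inf_n P_{p_c}[0 ⟷ ∂B(0, n)] ≤ θ_ℍ(p_c)`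
  (`DCTQ.le_theta_of_forall_le_real_armEvent`); with the PROVED Barsky–Grimmett–Newman theorem
  `θ_ℍ(p_c) = 0` (`BarskyGrimmettNewman1991_Z3_holds`) this gives `θ_ℍ(p) → 0` as `p ↓ p_c`
  (`exists_theta_lt_of_theta_eq_zero`);
* hence `Q(p_c) ≤ max(C,0) · η^a` for every `η > 0` (`p_c < 1`, `criticalProb_zd_lt_one`, supplies
  parameters `p ∈ (p_c, p_c + δ)`), and `η → 0⁺` with `a > 0` gives `Q(p_c) ≤ 0 ≤ Q(p_c)`.
-/

namespace Summit.CriticalPhenomena.PercolationContinuityZ3.Theorems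

open MeasureTheory Filter
open Literature.Probability.Percolation Literature.Probability.LatticeModels
open scoped Topology

/-- **`θ_v(p) ≤ P_p[v ⟷ ∂B(v, n)]`** for bond percolation on a locally finite graph with countably
many vertices and every radius `n`: an infinite open cluster at `v` is not contained in the finite
ball `B(v, n)`, and an open path to a vertex outside the ball exits it through `∂B(v, n)`
(valid for `ω ⊆ E(G)`, i.e. almost surely). (Grimmett 1999, §1.4, `θ(p) ≤ P_p(0 ⟷ ∂B(n))`.) -/
theorem theta_le_real_armEvent {V : Type*} [Countable V] [DecidableEq V] (G : SimpleGraph V)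
    [G.LocallyFinite] (v : V) (p : unitInterval) (n : ℕ) :
    theta G v p ≤ (bondPercolation G p).real (DCTQ.armEvent G v n) := by
  rw [theta]
  refine DCT16.real_mono_of_forall_subset_edgeSet G p fun ω hω hperc => ?_
  obtain ⟨y, hy, hyball⟩ :=
    (hperc : (openCluster ω v).Infinite).exists_notMem_finset (DCTQ.ball G v n)
  exact DCTQ.armEvent_of_pathIn (G := G) (m := n) hω (DCT16.pathIn_univ_of_reachable hy)
    (Or.inl hyball)

/-- **Upper semicontinuity of `θ` at a zero, quantitative form.** On a locally finite graph with
countably many vertices: if `θ_v(p₀) = 0` then for every `η > 0` there is `δ > 0` with `θ_v(p) < η`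
whenever `dist p p₀ < δ`. Indeed some arm event `{v ⟷ ∂B(v, n)}` has `P_{p₀}`-probability `< η/2`
(else `η/2 ≤ θ_v(p₀)` by `DCTQ.le_theta_of_forall_le_real_armEvent`), its probability is continuous
in `p` (a cylinder event), and it dominates `θ_v(p)`. (Grimmett 1999, §1.4 and §8.3: `θ` is the
decreasing limit of continuous functions.) -/
theorem exists_theta_lt_of_theta_eq_zero {V : Type*} [Countable V] [DecidableEq V]
    (G : SimpleGraph V) [G.LocallyFinite] (v : V) {p₀ : unitInterval} (h0 : theta G v p₀ = 0)
    {η : ℝ} (hη : 0 < η) :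
    ∃ δ > 0, ∀ p : unitInterval, dist p p₀ < δ → theta G v p < η := by
  -- some arm event has small probability at `p₀`
  obtain ⟨n, hn⟩ : ∃ n, (bondPercolation G p₀).real (DCTQ.armEvent G v n) < η / 2 := by
    by_contra hcon
    push Not at hcon
    have hle := DCTQ.le_theta_of_forall_le_real_armEvent (G := G) p₀ v hcon
    linarith
  -- its probability is continuous in `p`
  have hcont : Continuous fun p : unitInterval =>
      (bondPercolation G p).real (DCTQ.armEvent G v n) :=
    continuous_bondPercolation_real_of_determinedBy G (DCTQ.determinedBy_armEvent v n)
  obtain ⟨δ, hδ, hδ'⟩ := Metric.continuous_iff.1 hcont p₀ (η / 2) (half_pos hη)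
  refine ⟨δ, hδ, fun p hp => ?_⟩
  have h1 := hδ' p hp
  rw [Real.dist_eq] at h1
  have h2 := theta_le_real_armEvent G v p n
  have h3 := (abs_lt.1 h1).2
  linarith

/-- **Item `stmt-CriticalPhenomena-5270` (`PercNecklaceBackbone.NoBackboneOfBelowSurface`), proved.**
`BackboneBelowSurface → NoBackbone`: a supercritical bound `Q(p) ≤ C · θ_ℍ(p)^a` (`a > 0`,
`p > p_c(ℤ³)`) for the cut-form backbone density `Q(p) = P_p{∀ e, ω ∖ {e} ∈ {|C(0)| = ∞}}` forces
`Q(p_c) = 0`, by monotonicity of `Q` in `p` (increasing event), upper semicontinuity of the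
half-space percolation probability `θ_ℍ` together with the proved Barsky–Grimmett–Newman theorem
`θ_ℍ(p_c) = 0`, and `η^a → 0` as `η → 0⁺`. -/
theorem noBackboneOfBelowSurface_proof :
    Summit.CriticalPhenomena.PercolationContinuityZ3.Theses.PercNecklaceBackbone.NoBackboneOfBelowSurface := by
  unfold Summit.CriticalPhenomena.PercolationContinuityZ3.Theses.PercNecklaceBackbone.NoBackboneOfBelowSurface
    Summit.CriticalPhenomena.PercolationContinuityZ3.Theses.PercNecklaceBackbone.BackboneBelowSurface
    Summit.CriticalPhenomena.PercolationContinuityZ3.Theses.PercNecklaceBackbone.NoBackbone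
  rintro ⟨a, C, ha, hbound⟩
  classical
  set pc : unitInterval := criticalProbI 3 with hpc
  set Q : Set (BondConfig (Site 3)) :=
    {ω | ∀ e : Sym2 (Site 3), ω \ {e} ∈ percolatesAt (0 : Site 3)} with hQ
  set oH : {x : Site 3 | 0 ≤ x 0} := ⟨0, Set.mem_setOf.mpr le_rfl⟩ with hoH
  set H : SimpleGraph {x : Site 3 | 0 ≤ x 0} := (zdGraph 3).induce {x : Site 3 | 0 ≤ x 0} with hH
  -- `Q` is increasing and measurable
  have hQup : IsUpperSet Q := by
    intro ω ω' hle hω e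
    exact isUpperSet_percolatesAt (0 : Site 3) (Set.sdiff_subset_sdiff_left hle) (hω e)
  have hQm : MeasurableSet Q := by
    have hrepr : Q = ⋂ e : Sym2 (Site 3),
        (fun ω : BondConfig (Site 3) => ω \ {e}) ⁻¹' percolatesAt (0 : Site 3) := by
      ext ω
      simp only [hQ, Set.mem_setOf_eq, Set.mem_iInter, Set.mem_preimage]
    rw [hrepr]
    exact MeasurableSet.iInter fun e =>
      (measurableSet_percolatesAt_holds (0 : Site 3)).preimage
        (measurable_set_iff.2 fun f => (measurable_set_mem f).and measurable_const)
  -- Barsky–Grimmett–Newman (proved in tree): `θ_ℍ(p_c) = 0`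
  have hBGN : theta H oH pc = 0 := BarskyGrimmettNewman1991_Z3_holds
  -- `p_c(ℤ³) < 1`
  have hpc1 : (pc : ℝ) < 1 := by
    rw [hpc, coe_criticalProbI]
    exact criticalProb_zd_lt_one (by norm_num)
  -- the key estimate: `Q(p_c) ≤ max(C,0) · η^a` for every `η > 0`
  set C' : ℝ := max C 0 with hC'
  have key : ∀ η : ℝ, 0 < η → (bondPercolation (zdGraph 3) pc).real Q ≤ C' * η ^ a := by
    intro η hη
    obtain ⟨δ, hδ, hθ⟩ := exists_theta_lt_of_theta_eq_zero H oH hBGN hη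
    -- a parameter `p` with `p_c < p < p_c + δ`
    set t : ℝ := min 1 ((pc : ℝ) + δ / 2) with ht
    have ht0 : 0 ≤ t := le_min zero_le_one (by linarith [pc.2.1])
    have ht1 : t ≤ 1 := min_le_left _ _
    set p : unitInterval := ⟨t, ht0, ht1⟩ with hp
    have hpcp : (pc : ℝ) < p := by
      show (pc : ℝ) < t
      exact lt_min hpc1 (by linarith)
    have hdist : dist p pc < δ := by
      rw [Subtype.dist_eq, Real.dist_eq, abs_of_pos (sub_pos.2 hpcp)]
      show t - pc < δ
      have : t ≤ pc + δ / 2 := min_le_right _ _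
      linarith
    have hθp : theta H oH p < η := hθ p hdist
    have hθ0 : 0 ≤ theta H oH p := measureReal_nonneg
    have hpc_lt : criticalProb (zdGraph 3) (0 : Site 3) < (p : ℝ) := by
      rw [hpc, coe_criticalProbI] at hpcp
      exact hpcp
    calc (bondPercolation (zdGraph 3) pc).real Q
        ≤ (bondPercolation (zdGraph 3) p).real Q :=
          DCT16.real_mono_of_isUpperSet (zdGraph 3) hQup hQm (Subtype.coe_le_coe.1 hpcp.le)
      _ ≤ C * (theta H oH p) ^ a := hbound p hpc_lt
      _ ≤ C' * (theta H oH p) ^ a :=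
          mul_le_mul_of_nonneg_right (le_max_left _ _) (Real.rpow_nonneg hθ0 _)
      _ ≤ C' * η ^ a :=
          mul_le_mul_of_nonneg_left (Real.rpow_le_rpow hθ0 hθp.le ha.le) (le_max_right _ _)
  -- let `η → 0⁺`
  have hlim : Tendsto (fun η : ℝ => C' * η ^ a) (𝓝[>] 0) (𝓝 0) := by
    have hc : Continuous fun η : ℝ => C' * η ^ a :=
      continuous_const.mul (Real.continuous_rpow_const ha.le)
    have h := hc.tendsto 0
    simp only [Real.zero_rpow ha.ne', mul_zero] at h
    exact tendsto_nhdsWithin_of_tendsto_nhds h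
  have hle : (bondPercolation (zdGraph 3) pc).real Q ≤ 0 :=
    ge_of_tendsto hlim (eventually_nhdsWithin_of_forall fun η hη => key η hη)
  exact le_antisymm hle measureReal_nonneg

end Summit.CriticalPhenomena.PercolationContinuityZ3.Theorems
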